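import Literature.NumberTheory.DiophantineGeometry.GenEllFullGaloisProofs
import Literature.NumberTheory.DiophantineGeometry.GenEllLemma35Proofs
import HarnessLib

/-!
# [GenEll] Lemma 3.7 (Finite Exceptional Sets) — DISCHARGED

S. Mochizuki, *Arithmetic elliptic curves in general position*, Math. J. Okayama Univ. **52** (2010)
[cite: MochizukiGenEll2010], Lemma 3.7, p. 18 (quoted in `GenEllFullGalois.lean`).

The named fact `GenEll_lemma37` of `GenEllFullGalois.lean` (abc-iut-S4) HOLDS: the printed proof
(`GenEllFullGaloisProofs.lean`, abc-iut-S-d4: `GenEll_lemma37_of_lemma35_general`, i.e. Lemma 3.7 from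
Lemma 3.5 in the generality in which p. 18 invokes it) composed with [GenEll] Lemma 3.5 for semistable
curves over ARBITRARY number fields (`GenEll_lemma35_general`, `GenEllLemma35Proofs.lean`, abc-iut-S-d1:
quotient isogeny `E → E/H_F`, Faltings' isogeny inequality, the modular equation `Φ_l`, Prop. 3.4).
No named fact is consumed: the axioms of `GenEll_lemma37_holds` are the three standard ones.
DAG node `GenEll:Lem3.7` (abc-iut campaign S); proof-only; no definitions.
-/

namespace Literature.NumberTheory.DiophantineGeometry.GenEll

/-- **[GenEll] Lemma 3.7 (Finite Exceptional Sets), DISCHARGED**: for every compactly bounded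
`K_V ⊆ M_ell(Q̄)` and `ε > 0` there are `C > 0` and a Galois-finite exceptional set `Exc` such that for
every semistable `E_L` and prime `l`: (a) ⇒ `l >` the local heights at the primes of multiplicative
reduction; (b) and `[E_L] ∉ Exc` ⇒ a prime of multiplicative reduction exists; (a) or (b), with an
`l`-cyclic subgroup scheme, ⇒ `[E_L] ∈ Exc` — the tree's named fact `GenEll_lemma37`, by name.
[cite: MochizukiGenEll2010, Lem 3.7 p.18] -/
theorem GenEll_lemma37_holds : GenEll_lemma37 :=
  GenEll_lemma37_of_lemma35_general GenEll_lemma35_general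

end Literature.NumberTheory.DiophantineGeometry.GenEll
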